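import Mathlib
import Literature.Analysis.SpecialFunctions.LiebWuKernels
import Literature.Analysis.SpecialFunctions.SechSqFourier
import Literature.NumberTheory.LFunctions.RiemannXiShiftInequality
import Literature.Analysis.SpecialFunctions.GammaVerticalBounds
import HarnessLib

/-!
# The `sech`-chain integral `∫_{ℝ^l} ∏ᵢ sech(eᵢ) · sech(e₁ + ⋯ + e_l) de` in closed form — tool for Tosi's Theorem 1

Topic `Literature/NumberTheory/Irrationality/Tosi2026`. Everything here is PROVED (no named facts).

For `l : ℕ` let

`J_l := ∫_{ℝ^l} sech(e₁) sech(e₂) ⋯ sech(e_l) · sech(e₁ + e₂ + ⋯ + e_l) de₁ ⋯ de_l`,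

the `(l+1)`-fold convolution power of `sech` evaluated at `0` (the closed chain `0 → p₁ → ⋯ → p_l → 0`
with `sech` links, written in the increments `eᵢ = pᵢ − p_{i−1}`). We prove (`integral_sechChain`)

`J_l = 2^l · (π^{l+1}/π²) · Γ((l+1)/2)² / l!`

in three steps: (1) the Fourier transform of `sech` is `π sech(π² ·)` (`fourier_sechC`; Mathlib's
normalisation `𝓕 f (w) = ∫ f(t) e^{−2πitw} dt`; this is the tree's
`Literature.Analysis.SpecialFunctions.fourier_sechKernel`, i.e. the reflection-formula value
`Γ(½ + ib)Γ(½ − ib) = π/cosh πb` [AndrewsAskeyRoy1999, §1.4]); (2) Fourier inversion for `sech` at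
the point `e₁ + ⋯ + e_l`, Fubini over `ℝ^l × ℝ` and the factorisation `∫_{ℝ^l} ∏ᵢ h(eᵢ) = (∫ h)^l`
give `J_l = ∫_ℝ (π sech(π² w))^{l+1} dw` (`integral_sechChain_eq_integral_pow`); (3) the logistic
substitution `x = e^{2u}/(1+e^{2u})` (the tree's `sigm2`) and Euler's Beta integral
[AndrewsAskeyRoy1999, Thm. 1.1.4] give `∫_ℝ sechⁿ = 2^{n−1} Γ(n/2)²/Γ(n)` for `n ≥ 2`
(`integral_sech_pow`).

Purpose: with the substitution `x = tanh u` and the cyclic-shift lemma (`CyclicShiftLemma.lean`),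
`ξ_l = J_l/(l+1)` for Tosi's basic cellular integrals `ξ_l` [Tosi2026, Theorem 1]; this file is the
analytic half of that (new, elementary) proof of Tosi's theorem.

## References
* G. E. Andrews, R. Askey, R. Roy, *Special Functions* (1999), Thm. 1.1.4 (`B(x,y) = Γ(x)Γ(y)/Γ(x+y)`,
  read on the page) and §1.4 (`Γ(½+ib)Γ(½−ib) = π/cosh πb`, read on the page) [AndrewsAskeyRoy1999].
* R. Tosi, *An explicit study of a family of cellular integrals*, arXiv:2601.00346 (2026), Theorem 1
  [Tosi2026].
-/

noncomputable section

open _root_.MeasureTheory _root_.Set _root_.Finset _root_.Real _root_.FourierTransform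
  _root_.Filter

namespace Literature.NumberTheory.Irrationality.Tosi2026

open Literature.Analysis.SpecialFunctions (sechKernel sechKernel_pos integrable_sechKernel
  fourier_sechKernel integral_sechKernel fourier_const_mul_apply sigm2 sigm2_pos sigm2_lt_one
  one_sub_sigm2 sigm2_injective hasDerivAt_sigm2 image_sigm2_univ)
open Literature.NumberTheory.LFunctions (integral_rpow_mul_one_sub_rpow)

/-! ### The kernel `sech` -/

/-- The hyperbolic secant `sech t = 1/cosh t`. [folklore] -/
def sech (t : ℝ) : ℝ := 1 / Real.cosh t

/-- `sech > 0`. [cite: Tosi2026, Theorem 1 (alternative proof: the kernel)] -/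
theorem sech_pos (t : ℝ) : 0 < sech t := one_div_pos.mpr (Real.cosh_pos t)

/-- `sech ≤ 1`. [cite: Tosi2026, Theorem 1 (alternative proof: the kernel)] -/
theorem sech_le_one (t : ℝ) : sech t ≤ 1 := by
  unfold sech
  rw [div_le_one (Real.cosh_pos t)]
  exact Real.one_le_cosh t

/-- `sech` is even. [cite: Tosi2026, Theorem 1 (alternative proof: the kernel)] -/
@[simp] theorem sech_neg (t : ℝ) : sech (-t) = sech t := by simp [sech]

/-- `sech 0 = 1`. [cite: Tosi2026, Theorem 1 (alternative proof: the kernel)] -/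
@[simp] theorem sech_zero : sech 0 = 1 := by simp [sech]

/-- `sech` is continuous. [cite: Tosi2026, Theorem 1 (alternative proof: the kernel)] -/
theorem continuous_sech : Continuous sech :=
  continuous_const.div Real.continuous_cosh fun t => (Real.cosh_pos t).ne'

/-- `sech = π · r_{π/2}` in terms of the tree's Lieb–Wu kernel `r_c(x) = sech(πx/(2c))/(2c)`.
[cite: Tosi2026, Theorem 1 (alternative proof: the kernel)] -/
theorem sech_eq_pi_mul_sechKernel (t : ℝ) : sech t = π * sechKernel (π / 2) t := by
  unfold sech sechKernel
  have hπ : π ≠ 0 := Real.pi_pos.ne'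
  have hc : Real.cosh t ≠ 0 := (Real.cosh_pos t).ne'
  rw [show π * t / (2 * (π / 2)) = t by field_simp]
  field_simp

/-- `sech` is integrable on `ℝ`. [cite: Tosi2026, Theorem 1 (alternative proof: the kernel)] -/
theorem integrable_sech : Integrable sech := by
  have h := (integrable_sechKernel (by positivity : (0 : ℝ) < π / 2)).const_mul π
  refine h.congr (Eventually.of_forall fun t => ?_)
  exact (sech_eq_pi_mul_sechKernel t).symm

/-- `∫_ℝ sech = π`. [cite: AndrewsAskeyRoy1999, §1.4 (`Γ(½+ib)Γ(½−ib) = π/cosh πb`, at `b = 0`)] -/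
theorem integral_sech : ∫ t : ℝ, sech t = π := by
  simp_rw [sech_eq_pi_mul_sechKernel]
  rw [integral_const_mul, integral_sechKernel (by positivity : (0 : ℝ) < π / 2), mul_one]

/-- The transformed kernel `w ↦ π · sech(π² w)` is integrable.
[cite: AndrewsAskeyRoy1999, §1.4 (`Γ(½+ib)Γ(½−ib) = π/cosh πb`)] -/
theorem integrable_pi_mul_sech_sq_mul : Integrable fun w : ℝ => π * sech (π ^ 2 * w) := by
  have h : Integrable fun w : ℝ => sech (π ^ 2 * w) :=
    integrable_sech.comp_mul_left' (by positivity)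
  exact h.const_mul π

/-! ### The Fourier transform of `sech` -/

/-- `sech` as a complex-valued function. [folklore] -/
def sechC (t : ℝ) : ℂ := (sech t : ℂ)

/-- `sechC` is continuous. [cite: Tosi2026, Theorem 1 (alternative proof: the kernel)] -/
theorem continuous_sechC : Continuous sechC :=
  Complex.continuous_ofReal.comp continuous_sech

/-- `sechC` is integrable. [cite: Tosi2026, Theorem 1 (alternative proof: the kernel)] -/
theorem integrable_sechC : Integrable sechC := integrable_sech.ofReal

/-- `‖sechC t‖ = sech t`. [cite: Tosi2026, Theorem 1 (alternative proof: the kernel)] -/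
theorem norm_sechC (t : ℝ) : ‖sechC t‖ = sech t := by
  simp [sechC, abs_of_pos (sech_pos t)]

/-- The Fourier transform of `sech`, written as a real function: `Φ(w) = π · sech(π² w)`. [folklore] -/
def fsech (w : ℝ) : ℝ := π * sech (π ^ 2 * w)

/-- `Φ` is even. [cite: AndrewsAskeyRoy1999, §1.4 (`Γ(½+ib)Γ(½−ib) = π/cosh πb`)] -/
@[simp] theorem fsech_neg (w : ℝ) : fsech (-w) = fsech w := by simp [fsech]

/-- **The Fourier transform of `sech` is `π sech(π² ·)`** (Mathlib's normalisation
`𝓕 f (w) = ∫ f(t) e^{−2πitw} dt`); from the tree's `fourier_sechKernel`.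
[cite: AndrewsAskeyRoy1999, §1.4 (`Γ(½+ib)Γ(½−ib) = π/cosh πb`)] -/
theorem fourier_sechC (w : ℝ) : 𝓕 sechC w = ((fsech w : ℝ) : ℂ) := by
  have hfun : sechC = fun t : ℝ => (π : ℂ) * ((sechKernel (π / 2) t : ℝ) : ℂ) := by
    funext t
    simp only [sechC, sech_eq_pi_mul_sechKernel]
    push_cast
    ring
  rw [hfun, fourier_const_mul_apply, fourier_sechKernel (by positivity : (0 : ℝ) < π / 2)]
  rw [fsech, sech]
  rw [show 2 * π * (π / 2) * w = π ^ 2 * w by ring]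
  push_cast
  ring

/-- The Fourier transform of `sechC` as a function.
[cite: AndrewsAskeyRoy1999, §1.4 (`Γ(½+ib)Γ(½−ib) = π/cosh πb`)] -/
theorem fourier_sechC_eq : 𝓕 sechC = fun w : ℝ => ((fsech w : ℝ) : ℂ) :=
  funext fourier_sechC

/-- `Φ` is integrable. [cite: AndrewsAskeyRoy1999, §1.4 (`Γ(½+ib)Γ(½−ib) = π/cosh πb`)] -/
theorem integrable_fsech : Integrable fsech := integrable_pi_mul_sech_sq_mul

/-- **Fourier inversion for `sech`**: `sech x = ∫ e^{2πivx} Φ(v) dv`.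
[cite: AndrewsAskeyRoy1999, §1.4 (`Γ(½+ib)Γ(½−ib) = π/cosh πb`)] -/
theorem sechC_eq_integral (x : ℝ) :
    sechC x = ∫ v : ℝ, Complex.exp (↑(2 * π * v * x) * Complex.I) * ((fsech v : ℝ) : ℂ) := by
  have hinv := Continuous.fourierInv_fourier_eq continuous_sechC integrable_sechC
    (by rw [fourier_sechC_eq]; exact integrable_fsech.ofReal)
  have h := congr_fun hinv x
  rw [← h, Real.fourierInv_eq_fourier_neg, Real.fourier_real_eq_integral_exp_smul]
  refine integral_congr_ae (ae_of_all _ fun v => ?_)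
  dsimp only
  rw [fourier_sechC, smul_eq_mul]
  congr 2
  push_cast
  ring

/-- The conjugate-direction transform: `∫ sech(t) e^{2πivt} dt = Φ(v)` (evenness of `Φ`).
[cite: AndrewsAskeyRoy1999, §1.4 (`Γ(½+ib)Γ(½−ib) = π/cosh πb`)] -/
theorem integral_sechC_mul_exp (v : ℝ) :
    ∫ t : ℝ, sechC t * Complex.exp (↑(2 * π * v * t) * Complex.I) = ((fsech v : ℝ) : ℂ) := by
  have h := fourier_sechC (-v)
  rw [Real.fourier_real_eq_integral_exp_smul, fsech_neg] at h
  rw [← h]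
  refine integral_congr_ae (ae_of_all _ fun t => ?_)
  dsimp only
  rw [smul_eq_mul, mul_comm]
  congr 2
  push_cast
  ring

/-! ### The chain integral as a Fourier integral -/

/-- The integrand of `J_l` in the increments `e = (e₁,…,e_l)`: `∏ᵢ sech(eᵢ) · sech(e₁ + ⋯ + e_l)`.
[folklore] -/
def sechChain (l : ℕ) (e : Fin l → ℝ) : ℝ := (∏ i, sech (e i)) * sech (∑ i, e i)

/-- The chain integrand is nonnegative. [cite: Tosi2026, Theorem 1 (alternative proof: the chain integrand)] -/
theorem sechChain_nonneg (l : ℕ) (e : Fin l → ℝ) : 0 ≤ sechChain l e :=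
  mul_nonneg (Finset.prod_nonneg fun _ _ => (sech_pos _).le) (sech_pos _).le

/-- The chain integrand is continuous. [cite: Tosi2026, Theorem 1 (alternative proof: the chain integrand)] -/
theorem continuous_sechChain (l : ℕ) : Continuous (sechChain l) := by
  unfold sechChain
  refine Continuous.mul (continuous_finsetProd _ fun i _ => continuous_sech.comp (continuous_apply i))
    (continuous_sech.comp (continuous_finsetSum _ fun i _ => continuous_apply i))

/-- `e ↦ ∏ᵢ sech(eᵢ)` is integrable on `ℝ^l`. [cite: Tosi2026, Theorem 1 (alternative proof: the chain integrand)] -/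
theorem integrable_prod_sech (l : ℕ) : Integrable (fun e : Fin l → ℝ => ∏ i, sech (e i)) := by
  have h := Integrable.fintype_prod (ι := Fin l) (f := fun _ : Fin l => sech)
    (μ := fun _ : Fin l => (volume : Measure ℝ)) (fun _ => integrable_sech)
  simpa [volume_pi] using h

/-- `e ↦ ∏ᵢ sechC(eᵢ)` is integrable on `ℝ^l`. [cite: Tosi2026, Theorem 1 (alternative proof: the chain integrand)] -/
theorem integrable_prod_sechC (l : ℕ) : Integrable (fun e : Fin l → ℝ => ∏ i, sechC (e i)) := by
  have h := Integrable.fintype_prod (ι := Fin l) (f := fun _ : Fin l => sechC)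
    (μ := fun _ : Fin l => (volume : Measure ℝ)) (fun _ => integrable_sechC)
  simpa [volume_pi] using h

/-- The chain integrand is integrable on `ℝ^l`. [cite: Tosi2026, Theorem 1 (alternative proof: the chain integrand)] -/
theorem integrable_sechChain (l : ℕ) : Integrable (sechChain l) := by
  unfold sechChain
  refine (integrable_prod_sech l).mul_bdd (c := 1)
    ((continuous_sech.comp (continuous_finsetSum _ fun i _ => continuous_apply i)).aestronglyMeasurable)
    (Eventually.of_forall fun e => ?_)
  rw [Real.norm_eq_abs, abs_of_pos (sech_pos _)]
  exact sech_le_one _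

/-- `Φ` is continuous. [cite: AndrewsAskeyRoy1999, §1.4 (`Γ(½+ib)Γ(½−ib) = π/cosh πb`)] -/
theorem continuous_fsech : Continuous fsech := by
  unfold fsech
  exact continuous_const.mul (continuous_sech.comp (continuous_const.mul continuous_id))

/-- The joint integrand of the Fubini step:
`G(e, v) = ∏ᵢ sech(eᵢ) · e^{2πiv(e₁+⋯+e_l)} · Φ(v)`. [folklore] -/
def fubiniG (l : ℕ) (e : Fin l → ℝ) (v : ℝ) : ℂ :=
  (∏ i, sechC (e i)) * (Complex.exp (↑(2 * π * v * ∑ i, e i) * Complex.I) * ((fsech v : ℝ) : ℂ))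

/-- `G` is jointly continuous. [cite: Tosi2026, Theorem 1 (alternative proof: Fubini step)] -/
theorem continuous_fubiniG (l : ℕ) : Continuous (Function.uncurry (fubiniG l)) := by
  unfold fubiniG Function.uncurry
  refine Continuous.mul ?_ (Continuous.mul ?_ ?_)
  · exact continuous_finsetProd _ fun i _ =>
      continuous_sechC.comp ((continuous_apply i).comp continuous_fst)
  · refine Complex.continuous_exp.comp (Continuous.mul ?_ continuous_const)
    refine Complex.continuous_ofReal.comp ?_
    refine Continuous.mul (continuous_const.mul continuous_snd) ?_
    exact continuous_finsetSum _ fun i _ => (continuous_apply i).comp continuous_fst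
  · exact Complex.continuous_ofReal.comp (continuous_fsech.comp continuous_snd)

/-- `G` is integrable on `ℝ^l × ℝ` (its modulus is `∏ᵢ sech(eᵢ) · Φ(v)`).
[cite: Tosi2026, Theorem 1 (alternative proof: Fubini step)] -/
theorem integrable_fubiniG (l : ℕ) :
    Integrable (Function.uncurry (fubiniG l)) ((volume : Measure (Fin l → ℝ)).prod volume) := by
  have hAB : Integrable (fun z : (Fin l → ℝ) × ℝ => (∏ i, sechC (z.1 i)) * ((fsech z.2 : ℝ) : ℂ))
      ((volume : Measure (Fin l → ℝ)).prod volume) :=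
    (integrable_prod_sechC l).mul_prod integrable_fsech.ofReal
  refine hAB.mono (continuous_fubiniG l).aestronglyMeasurable (ae_of_all _ fun z => le_of_eq ?_)
  simp only [Function.uncurry, fubiniG, norm_mul, Complex.norm_exp_ofReal_mul_I, one_mul]

/-- The `e`-integral of `G(·, v)` factorises: `∫ G(e, v) de = Φ(v) · Φ(v)^l`.
[cite: Tosi2026, Theorem 1 (alternative proof: Fubini step)] -/
theorem integral_fubiniG_left (l : ℕ) (v : ℝ) :
    ∫ e : Fin l → ℝ, fubiniG l e v = ((fsech v : ℝ) : ℂ) * ((fsech v : ℝ) : ℂ) ^ l := by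
  have hpt : ∀ e : Fin l → ℝ, fubiniG l e v
      = ((fsech v : ℝ) : ℂ) * ∏ i, (sechC (e i) * Complex.exp (↑(2 * π * v * e i) * Complex.I)) := by
    intro e
    unfold fubiniG
    rw [Finset.prod_mul_distrib, ← Complex.exp_sum]
    have : ∑ i, (↑(2 * π * v * e i) * Complex.I) = (↑(2 * π * v * ∑ i, e i) : ℂ) * Complex.I := by
      rw [← Finset.sum_mul]
      push_cast
      rw [Finset.mul_sum]
    rw [this]
    ring
  simp_rw [hpt]
  rw [integral_const_mul]
  congr 1
  rw [integral_fintype_prod_volume_eq_pow (ι := Fin l)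
    (fun t : ℝ => sechC t * Complex.exp (↑(2 * π * v * t) * Complex.I))]
  rw [integral_sechC_mul_exp, Fintype.card_fin]

/-- **The chain integral is a Fourier integral**: `J_l = ∫_ℝ Φ(w)^{l+1} dw` with `Φ(w) = π sech(π² w)`
the Fourier transform of `sech` (Fourier inversion at `e₁ + ⋯ + e_l`, Fubini, factorisation).
[cite: Tosi2026, Theorem 1 (alternative proof: Fubini step)] -/
theorem integral_sechChain_eq_integral_pow (l : ℕ) :
    ∫ e : Fin l → ℝ, sechChain l e = ∫ w : ℝ, fsech w ^ (l + 1) := by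
  have key : (∫ e : Fin l → ℝ, ((sechChain l e : ℝ) : ℂ))
      = ∫ w : ℝ, (((fsech w) ^ (l + 1) : ℝ) : ℂ) := by
    have hpt : ∀ e : Fin l → ℝ, ((sechChain l e : ℝ) : ℂ) = ∫ v : ℝ, fubiniG l e v := by
      intro e
      have h1 : ((sechChain l e : ℝ) : ℂ) = (∏ i, sechC (e i)) * sechC (∑ i, e i) := by
        unfold sechChain sechC
        push_cast
        rfl
      rw [h1, sechC_eq_integral, ← integral_const_mul]
      rfl
    simp_rw [hpt]
    have hswap := integral_integral_swap (integrable_fubiniG l)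
    rw [hswap]
    refine integral_congr_ae (ae_of_all _ fun v => ?_)
    dsimp only
    rw [integral_fubiniG_left]
    push_cast
    ring
  rw [integral_complex_ofReal, integral_complex_ofReal] at key
  exact_mod_cast key

/-! ### Scaling and the Beta-function evaluation -/

/-- `∫ Φ^n = (π^n/π²) ∫ sechⁿ` (the substitution `y = π² w`).
[cite: Tosi2026, Theorem 1 (alternative proof: scaling step)] -/
theorem integral_fsech_pow (n : ℕ) :
    ∫ w : ℝ, fsech w ^ n = π ^ n / π ^ 2 * ∫ u : ℝ, sech u ^ n := by
  have h := Measure.integral_comp_mul_left (fun y : ℝ => sech y ^ n) (π ^ 2)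
  simp only [fsech, mul_pow]
  rw [integral_const_mul, h, abs_of_pos (by positivity), smul_eq_mul]
  field_simp

/-- `x(u)(1 − x(u)) = 1/(4cosh²u)` for the logistic substitution `x(u) = e^{2u}/(1+e^{2u})`.
[cite: AndrewsAskeyRoy1999, Thm. 1.1.4 (Beta integral; substitution)] -/
theorem sigm2_mul_one_sub (u : ℝ) : sigm2 u * (1 - sigm2 u) = 1 / (4 * Real.cosh u ^ 2) := by
  rw [one_sub_sigm2]
  unfold sigm2
  have hc : Real.cosh u ^ 2 = (1 + Real.exp (2 * u)) ^ 2 / (4 * Real.exp (2 * u)) := by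
    rw [Real.cosh_eq, show (2 : ℝ) * u = u + u by ring, Real.exp_add, Real.exp_neg]
    have : 0 < Real.exp u := Real.exp_pos u
    field_simp
    ring
  rw [hc]
  have : 0 < Real.exp (2 * u) := Real.exp_pos _
  have : 0 < 1 + Real.exp (2 * u) := by positivity
  field_simp

/-- Along the substitution, `x'(u) · 2^{n−1} (x(1−x))^{n/2−1} = sechⁿ u`.
[cite: AndrewsAskeyRoy1999, Thm. 1.1.4 (Beta integral; substitution)] -/
theorem jacobian_mul_betaDensity_sigm2 (n : ℕ) (u : ℝ) :
    |1 / (2 * Real.cosh u ^ 2)| • ((2 : ℝ) ^ n / 2 * (sigm2 u * (1 - sigm2 u)) ^ ((n : ℝ) / 2 - 1))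
      = sech u ^ n := by
  have hc : 0 < Real.cosh u := Real.cosh_pos u
  set s : ℝ := sigm2 u * (1 - sigm2 u) with hs_def
  have hs : s = 1 / (4 * Real.cosh u ^ 2) := sigm2_mul_one_sub u
  have hs0 : 0 < s := by rw [hs]; positivity
  -- the Jacobian is `2s`
  have hj : |1 / (2 * Real.cosh u ^ 2)| = 2 * s := by
    rw [abs_of_pos (by positivity), hs]
    field_simp
    norm_num
  -- `sech u ^ n = (4s)^{n/2} = 2^n s^{n/2}`
  have hsech : sech u ^ n = 2 ^ n * s ^ ((n : ℝ) / 2) := by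
    have h1 : sech u ^ 2 = 4 * s := by
      rw [hs, sech]
      field_simp
    have h2 : sech u ^ n = (sech u ^ 2) ^ ((n : ℝ) / 2) := by
      rw [← Real.rpow_natCast (sech u) n]
      conv_rhs => rw [← Real.rpow_natCast (sech u) 2, ← Real.rpow_mul (sech_pos u).le]
      congr 1
      push_cast
      ring
    rw [h2, h1, Real.mul_rpow (by norm_num) hs0.le]
    congr 1
    rw [show (4 : ℝ) = 2 ^ (2 : ℝ) by norm_num, ← Real.rpow_mul (by norm_num), ← Real.rpow_natCast]
    congr 1
    ring
  rw [hj, hsech, smul_eq_mul]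
  have hsplit : s ^ ((n : ℝ) / 2) = s ^ ((n : ℝ) / 2 - 1) * s := by
    rw [show (n : ℝ) / 2 = ((n : ℝ) / 2 - 1) + 1 by ring, Real.rpow_add_one hs0.ne']
    ring_nf
  rw [hsplit]
  ring

/-- **`∫_ℝ sechⁿ u du = 2^{n−1} Γ(n/2)²/Γ(n)`** for `n ≥ 2` (logistic substitution + Euler's Beta
integral `B(n/2, n/2)`). [cite: AndrewsAskeyRoy1999, Thm. 1.1.4 (Beta integral `B(x,y) = Γ(x)Γ(y)/Γ(x+y)`)] -/
theorem integral_sech_pow (n : ℕ) (hn : 2 ≤ n) :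
    ∫ u : ℝ, sech u ^ n = (2 : ℝ) ^ n / 2 * (Real.Gamma ((n : ℝ) / 2) ^ 2 / Real.Gamma n) := by
  set r : ℝ := (n : ℝ) / 2 with hr
  have hr0 : 0 < r := by
    rw [hr]
    have : (2 : ℝ) ≤ n := by exact_mod_cast hn
    linarith
  set g : ℝ → ℝ := fun x => (2 : ℝ) ^ n / 2 * (x * (1 - x)) ^ (r - 1) with hg
  have hcv := integral_image_eq_integral_abs_deriv_smul MeasurableSet.univ
    (fun u _ => (hasDerivAt_sigm2 u).hasDerivWithinAt) sigm2_injective.injOn g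
  rw [image_sigm2_univ, Measure.restrict_univ] at hcv
  have hpt : ∀ u : ℝ, |1 / (2 * Real.cosh u ^ 2)| • g (sigm2 u) = sech u ^ n := fun u => by
    simp only [hg, hr]
    exact jacobian_mul_betaDensity_sigm2 n u
  simp_rw [hpt] at hcv
  rw [← hcv]
  have hI : ∫ x in Ioo (0 : ℝ) 1, g x
      = (2 : ℝ) ^ n / 2 * ∫ x in (0 : ℝ)..1, x ^ (r - 1) * (1 - x) ^ (r - 1) := by
    rw [intervalIntegral.integral_of_le zero_le_one, integral_Ioc_eq_integral_Ioo,
      ← integral_const_mul]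
    refine setIntegral_congr_fun measurableSet_Ioo fun x hx => ?_
    simp only [hg]
    rw [Real.mul_rpow hx.1.le (by linarith [hx.2])]
  rw [hI, integral_rpow_mul_one_sub_rpow hr0 hr0]
  rw [show r + r = (n : ℝ) by rw [hr]; ring]
  ring

/-- **The `sech`-chain integral in closed form**:
`J_l = ∫_{ℝ^l} ∏ᵢ sech(eᵢ) · sech(e₁+⋯+e_l) de = 2^l · (π^{l+1}/π²) · Γ((l+1)/2)² / l!`.
[cite: Tosi2026, Theorem 1 (alternative proof: value of the whole-space chain integral)] -/
theorem integral_sechChain (l : ℕ) :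
    ∫ e : Fin l → ℝ, sechChain l e
      = 2 ^ l * (π ^ (l + 1) / π ^ 2) * (Real.Gamma (((l : ℝ) + 1) / 2) ^ 2 / l.factorial) := by
  rw [integral_sechChain_eq_integral_pow, integral_fsech_pow]
  rcases Nat.eq_zero_or_pos l with rfl | hl
  · simp only [zero_add, pow_one, Nat.factorial_zero, Nat.cast_one, div_one, pow_zero, one_mul,
      Nat.cast_zero]
    rw [integral_sech, Literature.Analysis.SpecialFunctions.GammaVert.Real_Gamma_half_sq]
  · rw [integral_sech_pow (l + 1) (by omega)]
    have hG : Real.Gamma ((l + 1 : ℕ) : ℝ) = (l.factorial : ℝ) := by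
      rw [show ((l + 1 : ℕ) : ℝ) = (l : ℝ) + 1 by push_cast; ring]
      exact Real.Gamma_nat_eq_factorial l
    rw [hG]
    push_cast
    ring

end Literature.NumberTheory.Irrationality.Tosi2026
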